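import Literature.MathematicalPhysics.QuantumFieldTheory.Balaban1983to89.Node00.Record13MonotoneHistoryOfBetaSign
import Literature.MathematicalPhysics.QuantumFieldTheory.Balaban1983to89.Node00.Record12BgRowCoClass

/-!
# NODE 00 (YM-PLAN Track A) — STAGE 13, CLASS EDITION (director-ym LINE №149 (3)): ROW P11's BODY PER DATUM FOR AN ARBITRARY BACKGROUND CONFIGURATION `U` FROM THE TWO CLASS
# BOUNDS FOR `U` — node00-def-P11's U-GENERIC assembly `bgRowAtDatumU_of_classBoundsC1` (FILE 10 `Record12BgRowCoClass` §2) LIFTED TO THE STAGE-13 PARAMETER, AT `θ` AND AT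
# `θ₁₅ᶜᶜ¹ = theta13OfThm1CC1`; THE UNIT BRANCH; AND THE C⁰ BOUND ∕ THE ROW FOR EVERY MINIMISER OVER PRINT'S CLASS (6) FROM THE CLASS-(6) FACT `VariationalThm1RegSepCo6`

Cell `pub-ymgap`, seat `pub-ymgap-node00-def-K0a` (g7), FILE 14c (sequel of 13d `Record13BgRowAtDatumOfClassC1`, which fixed def-R's (1.7)-class minimiser `UbgMSOfRecord … s 𝐖` as the
background).  [15] = [Balaban1985Variational], [6] = [Balaban1985RegularSpaces], [III] = [Balaban1988Convergent], [I] = [Balaban1987RG1].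

WHY BACKGROUND-GENERIC (director-ym №149 (1)–(3), №150: the `h9` guard on the (1.7)-class minimiser starves K1; the CLASS EDITION re-keys row P11's background to def-R's minimiser
over print's FULL class (6) = (1.7) ∧ (1.9), `UbgMSCoOfRecord` (node00-def-R FILE 22 `LargeFieldBackgroundCoOfRecord`), and node00-def-T's `Record13` v1.4 row reads it).  FILE 13d's lift
is keyed on the OLD minimiser token.  node00-def-P11's FILE 10 made the per-datum analysis GENERIC IN THE CONFIGURATION `U` (and the fact's suppliers GENERIC IN THE MINIMISER `U₀` over
(6)); lifting THOSE gives a θ-side supplier that names NO background object at all: for every run `p`, level `n ≤ K` in the window with compatible partitions, every sequence `s` and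
EVERY configuration `U`, the two class bounds for `U` imply the two memberships (I) ∧ (MS) for `U`.  Whatever carrier node00-def-T's v1.4 `bg` row reads, at a datum `(s, 𝐖)` it is
either def-R's Co minimiser (`isMinimizer_setOf_UbgMSCoOfRecord … hsol`: §3 applies with `U₀ :=` it) or the junk `1` off the solvable set (`UbgMSCoOfRecord_eq_one_of_not_mem`: §1's unit
branch applies) — so the v1.4 closers are this file restricted to the v1.4 range by `cases n; by_cases hsol` (FILE 14b′, after v1.4 lands).  This file needs neither def-R's leaf nor v1.4.

WHAT THIS FILE PROVES (theorems only; 0 `def`).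
* §1 (generic `θ`) ★ `Stage13Params.bgAtDatumU_of_classBoundsC1 (θ) (hθ) (hRz) (hB₃) (hB₃') (hM) (hε0 hBα hsN hcB hBCM hsmallI hsmallMS hC1 hletterI hletterMS)` :
  `∀ p n, n ≤ p.K → window → PartCompat₁₃ θ p n → ∀ s (U : GaugeField (F.P p.K) 0 (SU N)), C⁰(s, U) → C¹(s, U) → ∀ j, 1 ≤ j ≤ n → ∀ X, (I)(U) ∧ (MS)(U)` — NO `hsol`, NO datum `𝐖`,
  NO level split (FILE 13d's letters verbatim); `Stage13Params.bgAtDatum_one_of_admissible (θ) (hθ) (hRz)` : the row's body for `U = 1` at every windowed level (def-P11's `bgRowAtDatum_one`).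
* §2 (at `θ₁₅ᶜᶜ¹`, signs only) ★★★ `bgAtDatumU_theta13OfThm1CC1_of_pos (hε hε' hB hB' ha₀ ha₁)` (every letter by FILE 13b §2) · `bgAtDatum_one_theta13OfThm1CC1 (hε hε' hB hB' ha₀ ha₁)`.
* §3 (class-(6) fact, MINIMISER-GENERIC) ★★ `classC0U_theta13OfThm1CC1_of_thm1RegSepCo6 (hB hB' ha₀ ha₁) (h15 : VariationalThm1RegSepCo6 F N B₃ a₀ a₁) (hmono)` : at `θ₁₅ᶜᶜ¹`, for every
  windowed run, SEPARATED `s`, datum `𝐖` with print's (7) `Sect2.DataSmall7P`, EVERY minimiser `U₀` of (2.12) over the displayed class (6) at `εreg` has the C⁰ bound `B₃·cR·ε_m·η_m²` on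
  `omegaPlaqs s.Ω m` (def-P11's `plaqSmallOn_of_thm1RegSepCo6` + 13b's `hnum_`∕`εreg_le_`∕`hcomp_…_of_monotone`); ★★★ `bgAtMinimizerU_theta13OfThm1CC1_of_thm1RegSepCo6C1 (signs) (h15) (hmono)` :
  `… → PartCompat → ∀ s hsep 𝐖 h7 U₀ hmin, C¹(s, U₀) → row body for U₀` (§2 ∘ ★★); `…_of_betaLowerH (hb : 0 ≤ b) (hlow : FlowStep.BetaLowerH b ½ (betaOfRecord₁₃ F N θ₁₅ᶜᶜ¹))` ((hmono) by 13e).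

HONEST FRAMING.  Composition of tree theorems + index bookkeeping; CONDITIONAL on the DISPLAYED class bounds ∕ the DISPLAYED named fact `VariationalThm1RegSepCo6` ([15] Thm 1 (R) over
print's class (6) — a `Prop` hypothesis, NEVER asserted) and (hmono); nothing of Bałaban asserted; NOT a discharge; K0⁗∕K0⁵ NOT closed; counts unmoved (typed 28∕28 · discharged 5∕28);
one finite 𝕋⁴ programme at fixed ε — NOT continuum ∕ OS ∕ mass gap ∕ Clay.  No `sorry`, `axiom`, `def`, `instance`, `notation`.
-/

noncomputable section

open MeasureTheory
open scoped Matrix.Norms.L2Operator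

namespace Literature.MathematicalPhysics.QuantumFieldTheory.Balaban1983to89.Node00

open T4Continuum B14.Eq218Concrete B15DeterminingSets B12RegularSpaces111 B14RegularSpaces234 B14Radii T4AxialGaugeSmallField

/-! ## §1. ★ node00-def-P11's U-GENERIC `bgRowAtDatumU_of_classBoundsC1` LIFTED TO THE STAGE-13 PARAMETER (no background object, no solvable-set guard; letters as FILE 13d) -/

section LiftU

variable {F : T4Family} {N : ℕ} [NeZero N]

/-- **★ ROW P11's BODY FOR AN ARBITRARY CONFIGURATION `U` AT THE STAGE-13 RECORD, FROM THE TWO CLASS BOUNDS FOR `U`** — node00-def-P11's `bgRowAtDatumU_of_classBoundsC1` at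
`S := settingOfRecord₁₃ F N θ p`, level `n` (no split: no background token to unfold), with `b m := B₃·(cR·ε_m)`, `b′ m := B₃′·(cR·ε_m)`, the radii positive from admissibility in the
window and (C2) from the run-level antecedent `PartCompat₁₃ F N θ p n`: for every run `p`, level `n ≤ K` in the window with compatible partitions, EVERY sequence `s` and EVERY
`U : GaugeField (F.P p.K) 0 (SU N)`, the bounds `|U(∂p) − 1| < B₃·cR·ε_m·η_m²` on `omegaPlaqs s.Ω m` (`m ≤ n`) and covariant adjacent-plaquette differences `< B₃′·cR·ε_m·η_m³` inside
`Ω_m` (`1 ≤ m ≤ n`) imply `U ∈ U^c_j(X, α₀, α₁)` for `X ⊆ Λ_j` and `U ∈ Ũ^c_j(X)` for admissible `X`, `1 ≤ j ≤ n`.  A REDUCTION — nothing of Bałaban asserted.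
[cite: Balaban1985Variational, Thm 1 (8)–(10) p.279; Balaban1985RegularSpaces, (1.7)–(1.9) p.77; Balaban1988Convergent, (2.10) p.256, (2.27)–(2.28) p.259, (2.34)–(2.41) p.261, p.257; Balaban1987RG1, (1.11)–(1.16) p.262] -/
theorem Stage13Params.bgAtDatumU_of_classBoundsC1 (θ : Stage13Params F N) (hθ : θ.Admissible F N) (hRz : θ.Rz = RzOfRecord F N)
    {B₃ B₃' : ℝ} (hB₃ : 0 ≤ B₃) (hB₃' : 0 ≤ B₃') (hM : 0 < θ.τ9.M)
    (hε0 : ∀ (p : B12.RunParams) (n : ℕ), n ≤ p.K → Step.InInterval θ.γ n (gOfRecord₁₃ F N θ p) → ∀ m, m ≤ n → 0 ≤ θ.s2.cR * epsOfRecord θ.ν (gOfRecord₁₃ F N θ p) m)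
    (hBα : ∀ (p : B12.RunParams) (n : ℕ), n ≤ p.K → Step.InInterval θ.γ n (gOfRecord₁₃ F N θ p) → ∀ m, 1 ≤ m → m ≤ n →
      B₃ * (θ.s2.cR * epsOfRecord θ.ν (gOfRecord₁₃ F N θ p) m) ≤ (1 - θ.s2.βc) * (lfOfRecord₁₂ F N θ.toStage12Params).alpha0 (gOfRecord₁₃ F N θ p m))
    (hsN : ∀ (p : B12.RunParams) (n : ℕ), n ≤ p.K → ∀ n', 1 ≤ n' → n' ≤ n + 1 →
      ((B14.Eq213MaximalDomains.side (F.P p.K).L θ.τ9.M n' : ℕ) : ℤ) < (F.P p.K).sitesPerDir 0)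
    (hcB : ∀ p : B12.RunParams, 2 * (((F.P p.K).d - 1 : ℕ) : ℝ) * ((F.P p.K).L * θ.τ9.M) < θ.s2.cB)
    (hBCM : ∀ p : B12.RunParams, 2 * (((F.P p.K).d - 1 : ℕ) : ℝ) * θ.τ9.M < θ.s2.B * θ.s2.C * θ.s2.Mr)
    (hsmallI : ∀ (p : B12.RunParams) (n : ℕ), n ≤ p.K → Step.InInterval θ.γ n (gOfRecord₁₃ F N θ p) → ∀ j, 1 ≤ j → j ≤ n →
      (((F.P p.K).d - 1 : ℕ) : ℝ) * ((F.P p.K).L * θ.τ9.M) * (F.P p.K).eta j * (B₃ * (θ.s2.cR * epsOfRecord θ.ν (gOfRecord₁₃ F N θ p) j)) ≤ 1 / 2)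
    (hsmallMS : ∀ (p : B12.RunParams) (n : ℕ), n ≤ p.K → Step.InInterval θ.γ n (gOfRecord₁₃ F N θ p) → ∀ m, 1 ≤ m → m ≤ n →
      (((F.P p.K).d - 1 : ℕ) : ℝ) * θ.τ9.M * (F.P p.K).eta m * (B₃ * (θ.s2.cR * epsOfRecord θ.ν (gOfRecord₁₃ F N θ p) m)) ≤ 1 / 2)
    (hC1 : ∀ (p : B12.RunParams) (n : ℕ), n ≤ p.K → Step.InInterval θ.γ n (gOfRecord₁₃ F N θ p) → ∀ j, 1 ≤ j → j ≤ n →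
      ∃ t : ℕ, 0 < t ∧ RkOfRecord (F.P p.K).L θ.ν.r (gOfRecord₁₃ F N θ p j) = (F.P p.K).L * t)
    (hletterI : ∀ (p : B12.RunParams) (n : ℕ), n ≤ p.K → Step.InInterval θ.γ n (gOfRecord₁₃ F N θ p) → ∀ j, 1 ≤ j → j ≤ n →
      4 * (B₃ * (θ.s2.cR * epsOfRecord θ.ν (gOfRecord₁₃ F N θ p) j) + (((F.P p.K).d - 1 : ℕ) : ℝ) * (((F.P p.K).L : ℝ) * θ.τ9.M) * (B₃' * (θ.s2.cR * epsOfRecord θ.ν (gOfRecord₁₃ F N θ p) j)) +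
        4 * ((((F.P p.K).d - 1 : ℕ) : ℝ) * (((F.P p.K).L : ℝ) * θ.τ9.M)) ^ 2 * (B₃ * (θ.s2.cR * epsOfRecord θ.ν (gOfRecord₁₃ F N θ p) j)) ^ 2) <
        θ.s2.cB * (lfOfRecord₁₂ F N θ.toStage12Params).alpha0 (gOfRecord₁₃ F N θ p j))
    (hletterMS : ∀ (p : B12.RunParams) (n : ℕ), n ≤ p.K → Step.InInterval θ.γ n (gOfRecord₁₃ F N θ p) → ∀ m, 1 ≤ m → m ≤ n →
      4 * (B₃ * (θ.s2.cR * epsOfRecord θ.ν (gOfRecord₁₃ F N θ p) m) + (((F.P p.K).d - 1 : ℕ) : ℝ) * (θ.τ9.M : ℝ) * (B₃' * (θ.s2.cR * epsOfRecord θ.ν (gOfRecord₁₃ F N θ p) m)) +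
        4 * ((((F.P p.K).d - 1 : ℕ) : ℝ) * (θ.τ9.M : ℝ)) ^ 2 * (B₃ * (θ.s2.cR * epsOfRecord θ.ν (gOfRecord₁₃ F N θ p) m)) ^ 2) <
        rad238 θ.s2.B θ.s2.C θ.s2.Mr ((lfOfRecord₁₂ F N θ.toStage12Params).alpha0 (gOfRecord₁₃ F N θ p m))) :
    ∀ (p : B12.RunParams) (n : ℕ), n ≤ p.K → Step.InInterval θ.γ n (gOfRecord₁₃ F N θ p) → PartCompat₁₃ F N θ p n →
      ∀ (s : SeqOfRecord F θ.ν θ.τ9.M (gOfRecord₁₃ F N θ p) p.K n) (U : GaugeField (F.P p.K) 0 (SU N)),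
      (∀ m, m ≤ n → PlaqSmallOn (omegaPlaqs s.Ω m) (B₃ * (θ.s2.cR * epsOfRecord θ.ν (gOfRecord₁₃ F N θ p) m) * (F.P p.K).eta m ^ 2) U) →
      (∀ m, 1 ≤ m → m ≤ n → PlaqC1SmallOn (plaqInside (s.Ω m)) (B₃' * (θ.s2.cR * epsOfRecord θ.ν (gOfRecord₁₃ F N θ p) m) * (F.P p.K).eta m ^ 3) U) →
      ∀ j, 1 ≤ j → j ≤ n → ∀ X : (Sect2.domSys (F.P p.K) θ.τ9.M j).Dom,
      (Sect2.domSites (F.P p.K) θ.τ9.M j X ⊆ s.Λ j →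
        Sect2.ofBackgroundC (settingOfRecord₁₃ F N θ p).ι U ∈
          Sect2.spaceI (settingOfRecord₁₃ F N θ p) (θ.Rz p.K) θ.τ9.M j (Sect2.domSites (F.P p.K) θ.τ9.M j X)
            ((settingOfRecord₁₃ F N θ p).lf.alpha0 ((settingOfRecord₁₃ F N θ p).flow.g j)) ((settingOfRecord₁₃ F N θ p).lf.alpha1 ((settingOfRecord₁₃ F N θ p).flow.g j))) ∧
      (Sect2.admB (F.P p.K) θ.ν θ.τ9.M (gOfRecord₁₃ F N θ p) s.Ω s.Λ j (Sect2.domSites (F.P p.K) θ.τ9.M j X) = true →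
        Sect2.ofBackgroundC (settingOfRecord₁₃ F N θ p).ι U ∈
          Sect2.spaceMS (settingOfRecord₁₃ F N θ p) (θ.Rz p.K) θ.τ9.M j (Sect2.domSites (F.P p.K) θ.τ9.M j X) s.Ω) := by
  intro p n hn hw hpc
  rw [hRz]
  exact fun s U hc0 hc1 j h1 hj X =>
    bgRowAtDatumU_of_classBoundsC1 (settingOfRecord₁₃ F N θ p) rfl rfl (settingOfRecord₁₃_laws F N θ p) (settingOfRecord₁₃_pos F N θ hθ.1.pos p) θ.ν hM p.K n
      (b := fun m => B₃ * (θ.s2.cR * epsOfRecord θ.ν (gOfRecord₁₃ F N θ p) m)) (b' := fun m => B₃' * (θ.s2.cR * epsOfRecord θ.ν (gOfRecord₁₃ F N θ p) m))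
      (fun m hm => mul_nonneg hB₃ (hε0 p n hn hw m hm)) (fun m hm => mul_nonneg hB₃' (hε0 p n hn hw m hm)) s U hc0 hc1
      (fun m _ hm => alphaPos₁₃_of_inInterval hθ hw hm)
      (hBα p n hn hw) (hsN p n hn) (hcB p) (hBCM p) (hsmallI p n hn hw) (hsmallMS p n hn hw) (hC1 p n hn hw) hpc
      (hletterI p n hn hw) (hletterMS p n hn hw) j h1 hj X

/-- **THE UNIT CONFIGURATION SATISFIES ROW P11's BODY AT EVERY WINDOWED LEVEL OF THE STAGE-13 RECORD** — node00-def-P11's `bgRowAtDatum_one` at `S := settingOfRecord₁₃ F N θ p` (radii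
positive from admissibility in the window): the off-the-solvable-set branch of every TOTALISED minimiser of record (junk `1`, def-R's convention `…_eq_one_of_not_mem`).
[cite: Balaban1988Convergent, (2.12) p.256 (typing convention), (2.27)–(2.28) p.259; Balaban1987RG1, (1.11)–(1.16) p.262] -/
theorem Stage13Params.bgAtDatum_one_of_admissible (θ : Stage13Params F N) (hθ : θ.Admissible F N) (hRz : θ.Rz = RzOfRecord F N) :
    ∀ (p : B12.RunParams) (n : ℕ), Step.InInterval θ.γ n (gOfRecord₁₃ F N θ p) →
      ∀ (s : SeqOfRecord F θ.ν θ.τ9.M (gOfRecord₁₃ F N θ p) p.K n),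
      ∀ j, 1 ≤ j → j ≤ n → ∀ X : (Sect2.domSys (F.P p.K) θ.τ9.M j).Dom,
      (Sect2.domSites (F.P p.K) θ.τ9.M j X ⊆ s.Λ j →
        Sect2.ofBackgroundC (settingOfRecord₁₃ F N θ p).ι (1 : GaugeField (F.P p.K) 0 (SU N)) ∈
          Sect2.spaceI (settingOfRecord₁₃ F N θ p) (θ.Rz p.K) θ.τ9.M j (Sect2.domSites (F.P p.K) θ.τ9.M j X)
            ((settingOfRecord₁₃ F N θ p).lf.alpha0 ((settingOfRecord₁₃ F N θ p).flow.g j)) ((settingOfRecord₁₃ F N θ p).lf.alpha1 ((settingOfRecord₁₃ F N θ p).flow.g j))) ∧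
      (Sect2.admB (F.P p.K) θ.ν θ.τ9.M (gOfRecord₁₃ F N θ p) s.Ω s.Λ j (Sect2.domSites (F.P p.K) θ.τ9.M j X) = true →
        Sect2.ofBackgroundC (settingOfRecord₁₃ F N θ p).ι (1 : GaugeField (F.P p.K) 0 (SU N)) ∈
          Sect2.spaceMS (settingOfRecord₁₃ F N θ p) (θ.Rz p.K) θ.τ9.M j (Sect2.domSites (F.P p.K) θ.τ9.M j X) s.Ω) := by
  intro p n hw
  rw [hRz]
  exact fun s => bgRowAtDatum_one (settingOfRecord₁₃ F N θ p) (settingOfRecord₁₃_pos F N θ hθ.1.pos p) θ.ν θ.τ9.M p.K n s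
    (fun m _ hm => alphaPos₁₃_of_inInterval hθ hw hm)

end LiftU

/-! ## §2. ★★★ AT `θ₁₅ᶜᶜ¹`: row P11's body for an arbitrary `U` from the two class bounds for `U` — NOTHING BUT THE SIGNS AS HYPOTHESES; the unit branch -/

section AtWitnessU

variable {F : T4Family} {N : ℕ} [NeZero N] {ε₀ ε₂₉ B₃ B₃' a₀ a₁ : ℝ}

/-- **★★★ ROW P11's BODY FOR AN ARBITRARY CONFIGURATION `U` AT `θ₁₅ᶜᶜ¹ = theta13OfThm1CC1 F N ε₀ ε₂₉ B₃ B₃' a₀ a₁` — THE BACKGROUND-FREE SUPPLIER**: under the signs `0 < ε₀`,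
`0 < ε₂₉`, `0 ≤ B₃`, `0 ≤ B₃′`, `0 < a₀`, `0 < a₁` ONLY — for every run `p`, level `n ≤ K` in the window with compatible partitions, every sequence `s` and every `U`: the C⁰ bound on
`omegaPlaqs s.Ω m` (`m ≤ n`) and the C¹ bound inside `Ω_m` (`1 ≤ m ≤ n`) for `U` imply (I) ∧ (MS) for `U` (`1 ≤ j ≤ n`) — every numerics letter, (C1), no wrapping and both C¹-route
letters by FILE 13b §2, (C2) from the antecedent.  CONDITIONAL on the two bounds; nothing of Bałaban asserted.
[cite: Balaban1985Variational, Thm 1 (8)–(10) p.279; Balaban1985RegularSpaces, (1.7)–(1.9) p.77; Balaban1988Convergent, (2.10) p.256, (2.27)–(2.28) p.259, (2.34)–(2.41) p.261, p.257; Balaban1987RG1, (1.11)–(1.16) p.262] -/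
theorem bgAtDatumU_theta13OfThm1CC1_of_pos (hε : 0 < ε₀) (hε' : 0 < ε₂₉) (hB : 0 ≤ B₃) (hB' : 0 ≤ B₃') (ha₀ : 0 < a₀) (ha₁ : 0 < a₁) :
    ∀ (p : B12.RunParams) (n : ℕ), n ≤ p.K → Step.InInterval (theta13OfThm1CC1 F N ε₀ ε₂₉ B₃ B₃' a₀ a₁).γ n (gOfRecord₁₃ F N (theta13OfThm1CC1 F N ε₀ ε₂₉ B₃ B₃' a₀ a₁) p) → PartCompat₁₃ F N (theta13OfThm1CC1 F N ε₀ ε₂₉ B₃ B₃' a₀ a₁) p n →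
      ∀ (s : SeqOfRecord F (theta13OfThm1CC1 F N ε₀ ε₂₉ B₃ B₃' a₀ a₁).ν (theta13OfThm1CC1 F N ε₀ ε₂₉ B₃ B₃' a₀ a₁).τ9.M (gOfRecord₁₃ F N (theta13OfThm1CC1 F N ε₀ ε₂₉ B₃ B₃' a₀ a₁) p) p.K n) (U : GaugeField (F.P p.K) 0 (SU N)),
      (∀ m, m ≤ n → PlaqSmallOn (omegaPlaqs s.Ω m) (B₃ * ((theta13OfThm1CC1 F N ε₀ ε₂₉ B₃ B₃' a₀ a₁).s2.cR * epsOfRecord (theta13OfThm1CC1 F N ε₀ ε₂₉ B₃ B₃' a₀ a₁).ν (gOfRecord₁₃ F N (theta13OfThm1CC1 F N ε₀ ε₂₉ B₃ B₃' a₀ a₁) p) m) * (F.P p.K).eta m ^ 2) U) →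
      (∀ m, 1 ≤ m → m ≤ n → PlaqC1SmallOn (plaqInside (s.Ω m)) (B₃' * ((theta13OfThm1CC1 F N ε₀ ε₂₉ B₃ B₃' a₀ a₁).s2.cR * epsOfRecord (theta13OfThm1CC1 F N ε₀ ε₂₉ B₃ B₃' a₀ a₁).ν (gOfRecord₁₃ F N (theta13OfThm1CC1 F N ε₀ ε₂₉ B₃ B₃' a₀ a₁) p) m) * (F.P p.K).eta m ^ 3) U) →
      ∀ j, 1 ≤ j → j ≤ n → ∀ X : (Sect2.domSys (F.P p.K) (theta13OfThm1CC1 F N ε₀ ε₂₉ B₃ B₃' a₀ a₁).τ9.M j).Dom,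
      (Sect2.domSites (F.P p.K) (theta13OfThm1CC1 F N ε₀ ε₂₉ B₃ B₃' a₀ a₁).τ9.M j X ⊆ s.Λ j →
        Sect2.ofBackgroundC (settingOfRecord₁₃ F N (theta13OfThm1CC1 F N ε₀ ε₂₉ B₃ B₃' a₀ a₁) p).ι U ∈
          Sect2.spaceI (settingOfRecord₁₃ F N (theta13OfThm1CC1 F N ε₀ ε₂₉ B₃ B₃' a₀ a₁) p) ((theta13OfThm1CC1 F N ε₀ ε₂₉ B₃ B₃' a₀ a₁).Rz p.K) (theta13OfThm1CC1 F N ε₀ ε₂₉ B₃ B₃' a₀ a₁).τ9.M j (Sect2.domSites (F.P p.K) (theta13OfThm1CC1 F N ε₀ ε₂₉ B₃ B₃' a₀ a₁).τ9.M j X)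
            ((settingOfRecord₁₃ F N (theta13OfThm1CC1 F N ε₀ ε₂₉ B₃ B₃' a₀ a₁) p).lf.alpha0 ((settingOfRecord₁₃ F N (theta13OfThm1CC1 F N ε₀ ε₂₉ B₃ B₃' a₀ a₁) p).flow.g j)) ((settingOfRecord₁₃ F N (theta13OfThm1CC1 F N ε₀ ε₂₉ B₃ B₃' a₀ a₁) p).lf.alpha1 ((settingOfRecord₁₃ F N (theta13OfThm1CC1 F N ε₀ ε₂₉ B₃ B₃' a₀ a₁) p).flow.g j))) ∧
      (Sect2.admB (F.P p.K) (theta13OfThm1CC1 F N ε₀ ε₂₉ B₃ B₃' a₀ a₁).ν (theta13OfThm1CC1 F N ε₀ ε₂₉ B₃ B₃' a₀ a₁).τ9.M (gOfRecord₁₃ F N (theta13OfThm1CC1 F N ε₀ ε₂₉ B₃ B₃' a₀ a₁) p) s.Ω s.Λ j (Sect2.domSites (F.P p.K) (theta13OfThm1CC1 F N ε₀ ε₂₉ B₃ B₃' a₀ a₁).τ9.M j X) = true →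
        Sect2.ofBackgroundC (settingOfRecord₁₃ F N (theta13OfThm1CC1 F N ε₀ ε₂₉ B₃ B₃' a₀ a₁) p).ι U ∈
          Sect2.spaceMS (settingOfRecord₁₃ F N (theta13OfThm1CC1 F N ε₀ ε₂₉ B₃ B₃' a₀ a₁) p) ((theta13OfThm1CC1 F N ε₀ ε₂₉ B₃ B₃' a₀ a₁).Rz p.K) (theta13OfThm1CC1 F N ε₀ ε₂₉ B₃ B₃' a₀ a₁).τ9.M j (Sect2.domSites (F.P p.K) (theta13OfThm1CC1 F N ε₀ ε₂₉ B₃ B₃' a₀ a₁).τ9.M j X) s.Ω) :=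
  (theta13OfThm1CC1 F N ε₀ ε₂₉ B₃ B₃' a₀ a₁).bgAtDatumU_of_classBoundsC1 (admissible_theta13OfThm1CC1 F N hε hε' hB hB' ha₀ ha₁) rfl hB hB'
    (by rw [theta13OfThm1CC1_τ9_M]; exact Nat.one_pos) (hε0_theta13OfThm1CC1 hB hB' ha₀ ha₁) (hBα_theta13OfThm1CC1 hB hB' ha₀.le ha₁.le) hsN_theta13OfThm1CC1 hcB_theta13OfThm1CC1 hBCM_theta13OfThm1CC1
    (hsmallI_theta13OfThm1CC1 hB hB' ha₀ ha₁) (hsmallMS_theta13OfThm1CC1 hB hB' ha₀ ha₁) hC1_theta13OfThm1CC1 (hletterI_theta13OfThm1CC1 hB hB' ha₀ ha₁) (hletterMS_theta13OfThm1CC1 hB hB' ha₀ ha₁)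

/-- **THE UNIT BRANCH AT `θ₁₅ᶜᶜ¹`**: `1` satisfies row P11's body at every windowed level (signs only). [cite: Balaban1988Convergent, (2.12) p.256, (2.27)–(2.28) p.259; Balaban1987RG1, (1.11)–(1.16) p.262] -/
theorem bgAtDatum_one_theta13OfThm1CC1 (hε : 0 < ε₀) (hε' : 0 < ε₂₉) (hB : 0 ≤ B₃) (hB' : 0 ≤ B₃') (ha₀ : 0 < a₀) (ha₁ : 0 < a₁) :
    ∀ (p : B12.RunParams) (n : ℕ), Step.InInterval (theta13OfThm1CC1 F N ε₀ ε₂₉ B₃ B₃' a₀ a₁).γ n (gOfRecord₁₃ F N (theta13OfThm1CC1 F N ε₀ ε₂₉ B₃ B₃' a₀ a₁) p) →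
      ∀ (s : SeqOfRecord F (theta13OfThm1CC1 F N ε₀ ε₂₉ B₃ B₃' a₀ a₁).ν (theta13OfThm1CC1 F N ε₀ ε₂₉ B₃ B₃' a₀ a₁).τ9.M (gOfRecord₁₃ F N (theta13OfThm1CC1 F N ε₀ ε₂₉ B₃ B₃' a₀ a₁) p) p.K n),
      ∀ j, 1 ≤ j → j ≤ n → ∀ X : (Sect2.domSys (F.P p.K) (theta13OfThm1CC1 F N ε₀ ε₂₉ B₃ B₃' a₀ a₁).τ9.M j).Dom,
      (Sect2.domSites (F.P p.K) (theta13OfThm1CC1 F N ε₀ ε₂₉ B₃ B₃' a₀ a₁).τ9.M j X ⊆ s.Λ j →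
        Sect2.ofBackgroundC (settingOfRecord₁₃ F N (theta13OfThm1CC1 F N ε₀ ε₂₉ B₃ B₃' a₀ a₁) p).ι (1 : GaugeField (F.P p.K) 0 (SU N)) ∈
          Sect2.spaceI (settingOfRecord₁₃ F N (theta13OfThm1CC1 F N ε₀ ε₂₉ B₃ B₃' a₀ a₁) p) ((theta13OfThm1CC1 F N ε₀ ε₂₉ B₃ B₃' a₀ a₁).Rz p.K) (theta13OfThm1CC1 F N ε₀ ε₂₉ B₃ B₃' a₀ a₁).τ9.M j (Sect2.domSites (F.P p.K) (theta13OfThm1CC1 F N ε₀ ε₂₉ B₃ B₃' a₀ a₁).τ9.M j X)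
            ((settingOfRecord₁₃ F N (theta13OfThm1CC1 F N ε₀ ε₂₉ B₃ B₃' a₀ a₁) p).lf.alpha0 ((settingOfRecord₁₃ F N (theta13OfThm1CC1 F N ε₀ ε₂₉ B₃ B₃' a₀ a₁) p).flow.g j)) ((settingOfRecord₁₃ F N (theta13OfThm1CC1 F N ε₀ ε₂₉ B₃ B₃' a₀ a₁) p).lf.alpha1 ((settingOfRecord₁₃ F N (theta13OfThm1CC1 F N ε₀ ε₂₉ B₃ B₃' a₀ a₁) p).flow.g j))) ∧
      (Sect2.admB (F.P p.K) (theta13OfThm1CC1 F N ε₀ ε₂₉ B₃ B₃' a₀ a₁).ν (theta13OfThm1CC1 F N ε₀ ε₂₉ B₃ B₃' a₀ a₁).τ9.M (gOfRecord₁₃ F N (theta13OfThm1CC1 F N ε₀ ε₂₉ B₃ B₃' a₀ a₁) p) s.Ω s.Λ j (Sect2.domSites (F.P p.K) (theta13OfThm1CC1 F N ε₀ ε₂₉ B₃ B₃' a₀ a₁).τ9.M j X) = true →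
        Sect2.ofBackgroundC (settingOfRecord₁₃ F N (theta13OfThm1CC1 F N ε₀ ε₂₉ B₃ B₃' a₀ a₁) p).ι (1 : GaugeField (F.P p.K) 0 (SU N)) ∈
          Sect2.spaceMS (settingOfRecord₁₃ F N (theta13OfThm1CC1 F N ε₀ ε₂₉ B₃ B₃' a₀ a₁) p) ((theta13OfThm1CC1 F N ε₀ ε₂₉ B₃ B₃' a₀ a₁).Rz p.K) (theta13OfThm1CC1 F N ε₀ ε₂₉ B₃ B₃' a₀ a₁).τ9.M j (Sect2.domSites (F.P p.K) (theta13OfThm1CC1 F N ε₀ ε₂₉ B₃ B₃' a₀ a₁).τ9.M j X) s.Ω) :=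
  (theta13OfThm1CC1 F N ε₀ ε₂₉ B₃ B₃' a₀ a₁).bgAtDatum_one_of_admissible (admissible_theta13OfThm1CC1 F N hε hε' hB hB' ha₀ ha₁) rfl

end AtWitnessU

/-! ## §3. AT `θ₁₅ᶜᶜ¹`, FROM THE CLASS-(6) FACT `VariationalThm1RegSepCo6`: the C⁰ bound and ★★★ the row's body for EVERY MINIMISER over print's class (6) -/

section AtMinimizerU

variable {F : T4Family} {N : ℕ} [NeZero N] {ε₀ ε₂₉ B₃ B₃' a₀ a₁ : ℝ}

/-- **★★ THE C⁰ CLASS BOUND AT `θ₁₅ᶜᶜ¹` FOR EVERY MINIMISER OVER PRINT'S CLASS (6), FROM node00-def-P11's CLASS-(6) NAMED FACT `VariationalThm1RegSepCo6 F N B₃ a₀ a₁`** ([15] Thm 1,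
(R)-reading, the minimiser ranging over (6) = [6] (1.7) ∧ (1.9) at `εreg` — a `Prop` hypothesis, NEVER asserted) **AND THE MONOTONE WINDOWED HISTORY** (hmono): for every windowed run,
every SEPARATED `s`, every datum `𝐖` with print's (7) `Sect2.DataSmall7P` on the CONCORD range at the thresholds `cR·ε_j`, EVERY minimiser `U₀` of (2.12) on `genSet s.Ω n` over the
displayed class has `|U₀(∂p) − 1| < B₃·cR·ε_m·η_m²` on `omegaPlaqs s.Ω m`, `m ≤ n` — def-P11's `plaqSmallOn_of_thm1RegSepCo6` fed with FILE 13b §2's `hnum_` ∕ `εreg_le_` ∕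
`hcomp_…_of_monotone` (εreg = a₀ at `θ₁₅ᶜᶜ¹`).  The class is displayed as the set def-R's `regMSCoOfRecord` unfolds to (`regMSCoOfRecord_eq_setOf`, `rfl`); def-R's
`isMinimizer_setOf_UbgMSCoOfRecord … hsol` instantiates `U₀ := UbgMSCoOfRecord … s 𝐖`.  CONDITIONAL on the fact and (hmono); nothing of Bałaban asserted.
[cite: Balaban1985Variational, Thm 1 (2),(6)–(8) pp.278–279; Balaban1985RegularSpaces, (1.7)–(1.9) p.77; Balaban1988Convergent, (2.4)–(2.8) pp.255–256, (2.12) p.256] -/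
theorem classC0U_theta13OfThm1CC1_of_thm1RegSepCo6 (hB : 0 ≤ B₃) (hB' : 0 ≤ B₃') (ha₀ : 0 < a₀) (ha₁ : 0 < a₁)
    (h15 : VariationalThm1RegSepCo6 F N B₃ a₀ a₁)
    (hmono : ∀ (p : B12.RunParams) (n : ℕ), n ≤ p.K → Step.InInterval (theta13OfThm1CC1 F N ε₀ ε₂₉ B₃ B₃' a₀ a₁).γ n (gOfRecord₁₃ F N (theta13OfThm1CC1 F N ε₀ ε₂₉ B₃ B₃' a₀ a₁) p) → ∀ m, m < n →
      gOfRecord₁₃ F N (theta13OfThm1CC1 F N ε₀ ε₂₉ B₃ B₃' a₀ a₁) p m ≤ gOfRecord₁₃ F N (theta13OfThm1CC1 F N ε₀ ε₂₉ B₃ B₃' a₀ a₁) p (m + 1)) :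
    ∀ (p : B12.RunParams) (n : ℕ), n ≤ p.K → Step.InInterval (theta13OfThm1CC1 F N ε₀ ε₂₉ B₃ B₃' a₀ a₁).γ n (gOfRecord₁₃ F N (theta13OfThm1CC1 F N ε₀ ε₂₉ B₃ B₃' a₀ a₁) p) →
      ∀ (s : SeqOfRecord F (theta13OfThm1CC1 F N ε₀ ε₂₉ B₃ B₃' a₀ a₁).ν (theta13OfThm1CC1 F N ε₀ ε₂₉ B₃ B₃' a₀ a₁).τ9.M (gOfRecord₁₃ F N (theta13OfThm1CC1 F N ε₀ ε₂₉ B₃ B₃' a₀ a₁) p) p.K n), Sect2.SeqSeparated (theta13OfThm1CC1 F N ε₀ ε₂₉ B₃ B₃' a₀ a₁).ν.M₁ s →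
      ∀ (W : MSField (F.P p.K) (SU N)), Sect2.DataSmall7P (avOfRecord F N p.K) s.Ω n (fun j => (theta13OfThm1CC1 F N ε₀ ε₂₉ B₃ B₃' a₀ a₁).s2.cR * epsOfRecord (theta13OfThm1CC1 F N ε₀ ε₂₉ B₃ B₃' a₀ a₁).ν (gOfRecord₁₃ F N (theta13OfThm1CC1 F N ε₀ ε₂₉ B₃ B₃' a₀ a₁) p) j) W →
      ∀ (U₀ : GaugeField (F.P p.K) 0 (SU N)), IsMinimizer (avOfRecord F N p.K)
          {U | (∀ m, m ≤ n → PlaqSmallOn (omegaPlaqs s.Ω m) ((theta13OfThm1CC1 F N ε₀ ε₂₉ B₃ B₃' a₀ a₁).ν.εreg * (F.P p.K).eta m ^ 2) U) ∧ Sect2.CoDivClassOn s.Ω n (theta13OfThm1CC1 F N ε₀ ε₂₉ B₃ B₃' a₀ a₁).ν.εreg U} (genSet s.Ω n) W U₀ →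
      (∀ m, m ≤ n → PlaqSmallOn (omegaPlaqs s.Ω m) (B₃ * ((theta13OfThm1CC1 F N ε₀ ε₂₉ B₃ B₃' a₀ a₁).s2.cR * epsOfRecord (theta13OfThm1CC1 F N ε₀ ε₂₉ B₃ B₃' a₀ a₁).ν (gOfRecord₁₃ F N (theta13OfThm1CC1 F N ε₀ ε₂₉ B₃ B₃' a₀ a₁) p) m) * (F.P p.K).eta m ^ 2) U₀) :=
  fun p n hn hw s hsep _ h7 _ hmin =>
    plaqSmallOn_of_thm1RegSepCo6 h15 (theta13OfThm1CC1 F N ε₀ ε₂₉ B₃ B₃' a₀ a₁).ν (theta13OfThm1CC1 F N ε₀ ε₂₉ B₃ B₃' a₀ a₁).τ9.M (gOfRecord₁₃ F N (theta13OfThm1CC1 F N ε₀ ε₂₉ B₃ B₃' a₀ a₁) p) p.K n (theta13OfThm1CC1 F N ε₀ ε₂₉ B₃ B₃' a₀ a₁).s2.cR s hsep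
      (hnum_theta13OfThm1CC1 hB hB' ha₀ ha₁ p n hn hw) εreg_le_theta13OfThm1CC1 (hcomp_theta13OfThm1CC1_of_monotone hB hB' ha₀.le ha₁.le hmono p n hn hw) h7 hmin

/-- **★★★ ROW P11's BODY AT `θ₁₅ᶜᶜ¹` FOR EVERY MINIMISER `U₀` OVER PRINT'S CLASS (6)** from the class-(6) fact (⇒ the C⁰ bound, ★★), the monotone windowed history and the DISPLAYED
C¹ class bound for `U₀` ([15] Thm 1 (9)–(10), gauge-free reading), along every windowed partition-compatible run, for separated `s` and (7)-small data — §2 ∘ ★★.  The v1.4 row of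
record at a solvable datum is this at `U₀ := UbgMSCoOfRecord … s 𝐖` (node00-def-R FILE 22).  CONDITIONAL; nothing of Bałaban asserted.
[cite: Balaban1985Variational, (7) p.278, Thm 1 (2),(6)–(10) pp.278–279; Balaban1985RegularSpaces, (1.3)–(1.9) p.77; Balaban1988Convergent, (2.4)–(2.8) pp.255–256, (2.10) p.256, (2.12) p.256, (2.27)–(2.28) p.259, (2.34)–(2.41) p.261, p.257; Balaban1987RG1, (1.11)–(1.16) p.262] -/
theorem bgAtMinimizerU_theta13OfThm1CC1_of_thm1RegSepCo6C1 (hε : 0 < ε₀) (hε' : 0 < ε₂₉) (hB : 0 ≤ B₃) (hB' : 0 ≤ B₃') (ha₀ : 0 < a₀) (ha₁ : 0 < a₁)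
    (h15 : VariationalThm1RegSepCo6 F N B₃ a₀ a₁)
    (hmono : ∀ (p : B12.RunParams) (n : ℕ), n ≤ p.K → Step.InInterval (theta13OfThm1CC1 F N ε₀ ε₂₉ B₃ B₃' a₀ a₁).γ n (gOfRecord₁₃ F N (theta13OfThm1CC1 F N ε₀ ε₂₉ B₃ B₃' a₀ a₁) p) → ∀ m, m < n →
      gOfRecord₁₃ F N (theta13OfThm1CC1 F N ε₀ ε₂₉ B₃ B₃' a₀ a₁) p m ≤ gOfRecord₁₃ F N (theta13OfThm1CC1 F N ε₀ ε₂₉ B₃ B₃' a₀ a₁) p (m + 1)) :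
    ∀ (p : B12.RunParams) (n : ℕ), n ≤ p.K → Step.InInterval (theta13OfThm1CC1 F N ε₀ ε₂₉ B₃ B₃' a₀ a₁).γ n (gOfRecord₁₃ F N (theta13OfThm1CC1 F N ε₀ ε₂₉ B₃ B₃' a₀ a₁) p) → PartCompat₁₃ F N (theta13OfThm1CC1 F N ε₀ ε₂₉ B₃ B₃' a₀ a₁) p n →
      ∀ (s : SeqOfRecord F (theta13OfThm1CC1 F N ε₀ ε₂₉ B₃ B₃' a₀ a₁).ν (theta13OfThm1CC1 F N ε₀ ε₂₉ B₃ B₃' a₀ a₁).τ9.M (gOfRecord₁₃ F N (theta13OfThm1CC1 F N ε₀ ε₂₉ B₃ B₃' a₀ a₁) p) p.K n), Sect2.SeqSeparated (theta13OfThm1CC1 F N ε₀ ε₂₉ B₃ B₃' a₀ a₁).ν.M₁ s →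
      ∀ (W : MSField (F.P p.K) (SU N)), Sect2.DataSmall7P (avOfRecord F N p.K) s.Ω n (fun j => (theta13OfThm1CC1 F N ε₀ ε₂₉ B₃ B₃' a₀ a₁).s2.cR * epsOfRecord (theta13OfThm1CC1 F N ε₀ ε₂₉ B₃ B₃' a₀ a₁).ν (gOfRecord₁₃ F N (theta13OfThm1CC1 F N ε₀ ε₂₉ B₃ B₃' a₀ a₁) p) j) W →
      ∀ (U₀ : GaugeField (F.P p.K) 0 (SU N)), IsMinimizer (avOfRecord F N p.K)
          {U | (∀ m, m ≤ n → PlaqSmallOn (omegaPlaqs s.Ω m) ((theta13OfThm1CC1 F N ε₀ ε₂₉ B₃ B₃' a₀ a₁).ν.εreg * (F.P p.K).eta m ^ 2) U) ∧ Sect2.CoDivClassOn s.Ω n (theta13OfThm1CC1 F N ε₀ ε₂₉ B₃ B₃' a₀ a₁).ν.εreg U} (genSet s.Ω n) W U₀ →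
      (∀ m, 1 ≤ m → m ≤ n → PlaqC1SmallOn (plaqInside (s.Ω m)) (B₃' * ((theta13OfThm1CC1 F N ε₀ ε₂₉ B₃ B₃' a₀ a₁).s2.cR * epsOfRecord (theta13OfThm1CC1 F N ε₀ ε₂₉ B₃ B₃' a₀ a₁).ν (gOfRecord₁₃ F N (theta13OfThm1CC1 F N ε₀ ε₂₉ B₃ B₃' a₀ a₁) p) m) * (F.P p.K).eta m ^ 3) U₀) →
      ∀ j, 1 ≤ j → j ≤ n → ∀ X : (Sect2.domSys (F.P p.K) (theta13OfThm1CC1 F N ε₀ ε₂₉ B₃ B₃' a₀ a₁).τ9.M j).Dom,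
      (Sect2.domSites (F.P p.K) (theta13OfThm1CC1 F N ε₀ ε₂₉ B₃ B₃' a₀ a₁).τ9.M j X ⊆ s.Λ j →
        Sect2.ofBackgroundC (settingOfRecord₁₃ F N (theta13OfThm1CC1 F N ε₀ ε₂₉ B₃ B₃' a₀ a₁) p).ι U₀ ∈
          Sect2.spaceI (settingOfRecord₁₃ F N (theta13OfThm1CC1 F N ε₀ ε₂₉ B₃ B₃' a₀ a₁) p) ((theta13OfThm1CC1 F N ε₀ ε₂₉ B₃ B₃' a₀ a₁).Rz p.K) (theta13OfThm1CC1 F N ε₀ ε₂₉ B₃ B₃' a₀ a₁).τ9.M j (Sect2.domSites (F.P p.K) (theta13OfThm1CC1 F N ε₀ ε₂₉ B₃ B₃' a₀ a₁).τ9.M j X)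
            ((settingOfRecord₁₃ F N (theta13OfThm1CC1 F N ε₀ ε₂₉ B₃ B₃' a₀ a₁) p).lf.alpha0 ((settingOfRecord₁₃ F N (theta13OfThm1CC1 F N ε₀ ε₂₉ B₃ B₃' a₀ a₁) p).flow.g j)) ((settingOfRecord₁₃ F N (theta13OfThm1CC1 F N ε₀ ε₂₉ B₃ B₃' a₀ a₁) p).lf.alpha1 ((settingOfRecord₁₃ F N (theta13OfThm1CC1 F N ε₀ ε₂₉ B₃ B₃' a₀ a₁) p).flow.g j))) ∧
      (Sect2.admB (F.P p.K) (theta13OfThm1CC1 F N ε₀ ε₂₉ B₃ B₃' a₀ a₁).ν (theta13OfThm1CC1 F N ε₀ ε₂₉ B₃ B₃' a₀ a₁).τ9.M (gOfRecord₁₃ F N (theta13OfThm1CC1 F N ε₀ ε₂₉ B₃ B₃' a₀ a₁) p) s.Ω s.Λ j (Sect2.domSites (F.P p.K) (theta13OfThm1CC1 F N ε₀ ε₂₉ B₃ B₃' a₀ a₁).τ9.M j X) = true →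
        Sect2.ofBackgroundC (settingOfRecord₁₃ F N (theta13OfThm1CC1 F N ε₀ ε₂₉ B₃ B₃' a₀ a₁) p).ι U₀ ∈
          Sect2.spaceMS (settingOfRecord₁₃ F N (theta13OfThm1CC1 F N ε₀ ε₂₉ B₃ B₃' a₀ a₁) p) ((theta13OfThm1CC1 F N ε₀ ε₂₉ B₃ B₃' a₀ a₁).Rz p.K) (theta13OfThm1CC1 F N ε₀ ε₂₉ B₃ B₃' a₀ a₁).τ9.M j (Sect2.domSites (F.P p.K) (theta13OfThm1CC1 F N ε₀ ε₂₉ B₃ B₃' a₀ a₁).τ9.M j X) s.Ω) :=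
  fun p n hn hw hpc s hsep W h7 U₀ hmin hC1U =>
    bgAtDatumU_theta13OfThm1CC1_of_pos hε hε' hB hB' ha₀ ha₁ p n hn hw hpc s U₀
      (classC0U_theta13OfThm1CC1_of_thm1RegSepCo6 hB hB' ha₀ ha₁ h15 hmono p n hn hw s hsep W h7 U₀ hmin) hC1U

/-- **★★★ THE SAME WITH (hmono) FROM THE β-SIGN LEAF** `FlowStep.BetaLowerH b ½ (betaOfRecord₁₃ F N θ₁₅ᶜᶜ¹)`, `0 ≤ b` (FILE 13e `hmono_theta13OfThm1CC1_of_betaLowerH`; the DAG's located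
AF∕sign input at the record's β₁₃).  CONDITIONAL; nothing of Bałaban asserted. [cite: Balaban1985Variational, Thm 1 (6)–(10) pp.278–279; Balaban1987RG1, (0.20) p.256, Thm 2 p.259; Balaban1988Convergent, (2.4)–(2.8) pp.255–256, (2.27)–(2.28) p.259, (2.34)–(2.41) p.261] -/
theorem bgAtMinimizerU_theta13OfThm1CC1_of_thm1RegSepCo6C1_of_betaLowerH (hε : 0 < ε₀) (hε' : 0 < ε₂₉) (hB : 0 ≤ B₃) (hB' : 0 ≤ B₃') (ha₀ : 0 < a₀) (ha₁ : 0 < a₁)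
    (h15 : VariationalThm1RegSepCo6 F N B₃ a₀ a₁) {b : ℝ} (hb : 0 ≤ b) (hlow : FlowStep.BetaLowerH b (1 / 2) (betaOfRecord₁₃ F N (theta13OfThm1CC1 F N ε₀ ε₂₉ B₃ B₃' a₀ a₁))) :
    ∀ (p : B12.RunParams) (n : ℕ), n ≤ p.K → Step.InInterval (theta13OfThm1CC1 F N ε₀ ε₂₉ B₃ B₃' a₀ a₁).γ n (gOfRecord₁₃ F N (theta13OfThm1CC1 F N ε₀ ε₂₉ B₃ B₃' a₀ a₁) p) → PartCompat₁₃ F N (theta13OfThm1CC1 F N ε₀ ε₂₉ B₃ B₃' a₀ a₁) p n →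
      ∀ (s : SeqOfRecord F (theta13OfThm1CC1 F N ε₀ ε₂₉ B₃ B₃' a₀ a₁).ν (theta13OfThm1CC1 F N ε₀ ε₂₉ B₃ B₃' a₀ a₁).τ9.M (gOfRecord₁₃ F N (theta13OfThm1CC1 F N ε₀ ε₂₉ B₃ B₃' a₀ a₁) p) p.K n), Sect2.SeqSeparated (theta13OfThm1CC1 F N ε₀ ε₂₉ B₃ B₃' a₀ a₁).ν.M₁ s →
      ∀ (W : MSField (F.P p.K) (SU N)), Sect2.DataSmall7P (avOfRecord F N p.K) s.Ω n (fun j => (theta13OfThm1CC1 F N ε₀ ε₂₉ B₃ B₃' a₀ a₁).s2.cR * epsOfRecord (theta13OfThm1CC1 F N ε₀ ε₂₉ B₃ B₃' a₀ a₁).ν (gOfRecord₁₃ F N (theta13OfThm1CC1 F N ε₀ ε₂₉ B₃ B₃' a₀ a₁) p) j) W →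
      ∀ (U₀ : GaugeField (F.P p.K) 0 (SU N)), IsMinimizer (avOfRecord F N p.K)
          {U | (∀ m, m ≤ n → PlaqSmallOn (omegaPlaqs s.Ω m) ((theta13OfThm1CC1 F N ε₀ ε₂₉ B₃ B₃' a₀ a₁).ν.εreg * (F.P p.K).eta m ^ 2) U) ∧ Sect2.CoDivClassOn s.Ω n (theta13OfThm1CC1 F N ε₀ ε₂₉ B₃ B₃' a₀ a₁).ν.εreg U} (genSet s.Ω n) W U₀ →
      (∀ m, 1 ≤ m → m ≤ n → PlaqC1SmallOn (plaqInside (s.Ω m)) (B₃' * ((theta13OfThm1CC1 F N ε₀ ε₂₉ B₃ B₃' a₀ a₁).s2.cR * epsOfRecord (theta13OfThm1CC1 F N ε₀ ε₂₉ B₃ B₃' a₀ a₁).ν (gOfRecord₁₃ F N (theta13OfThm1CC1 F N ε₀ ε₂₉ B₃ B₃' a₀ a₁) p) m) * (F.P p.K).eta m ^ 3) U₀) →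
      ∀ j, 1 ≤ j → j ≤ n → ∀ X : (Sect2.domSys (F.P p.K) (theta13OfThm1CC1 F N ε₀ ε₂₉ B₃ B₃' a₀ a₁).τ9.M j).Dom,
      (Sect2.domSites (F.P p.K) (theta13OfThm1CC1 F N ε₀ ε₂₉ B₃ B₃' a₀ a₁).τ9.M j X ⊆ s.Λ j →
        Sect2.ofBackgroundC (settingOfRecord₁₃ F N (theta13OfThm1CC1 F N ε₀ ε₂₉ B₃ B₃' a₀ a₁) p).ι U₀ ∈
          Sect2.spaceI (settingOfRecord₁₃ F N (theta13OfThm1CC1 F N ε₀ ε₂₉ B₃ B₃' a₀ a₁) p) ((theta13OfThm1CC1 F N ε₀ ε₂₉ B₃ B₃' a₀ a₁).Rz p.K) (theta13OfThm1CC1 F N ε₀ ε₂₉ B₃ B₃' a₀ a₁).τ9.M j (Sect2.domSites (F.P p.K) (theta13OfThm1CC1 F N ε₀ ε₂₉ B₃ B₃' a₀ a₁).τ9.M j X)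
            ((settingOfRecord₁₃ F N (theta13OfThm1CC1 F N ε₀ ε₂₉ B₃ B₃' a₀ a₁) p).lf.alpha0 ((settingOfRecord₁₃ F N (theta13OfThm1CC1 F N ε₀ ε₂₉ B₃ B₃' a₀ a₁) p).flow.g j)) ((settingOfRecord₁₃ F N (theta13OfThm1CC1 F N ε₀ ε₂₉ B₃ B₃' a₀ a₁) p).lf.alpha1 ((settingOfRecord₁₃ F N (theta13OfThm1CC1 F N ε₀ ε₂₉ B₃ B₃' a₀ a₁) p).flow.g j))) ∧
      (Sect2.admB (F.P p.K) (theta13OfThm1CC1 F N ε₀ ε₂₉ B₃ B₃' a₀ a₁).ν (theta13OfThm1CC1 F N ε₀ ε₂₉ B₃ B₃' a₀ a₁).τ9.M (gOfRecord₁₃ F N (theta13OfThm1CC1 F N ε₀ ε₂₉ B₃ B₃' a₀ a₁) p) s.Ω s.Λ j (Sect2.domSites (F.P p.K) (theta13OfThm1CC1 F N ε₀ ε₂₉ B₃ B₃' a₀ a₁).τ9.M j X) = true →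
        Sect2.ofBackgroundC (settingOfRecord₁₃ F N (theta13OfThm1CC1 F N ε₀ ε₂₉ B₃ B₃' a₀ a₁) p).ι U₀ ∈
          Sect2.spaceMS (settingOfRecord₁₃ F N (theta13OfThm1CC1 F N ε₀ ε₂₉ B₃ B₃' a₀ a₁) p) ((theta13OfThm1CC1 F N ε₀ ε₂₉ B₃ B₃' a₀ a₁).Rz p.K) (theta13OfThm1CC1 F N ε₀ ε₂₉ B₃ B₃' a₀ a₁).τ9.M j (Sect2.domSites (F.P p.K) (theta13OfThm1CC1 F N ε₀ ε₂₉ B₃ B₃' a₀ a₁).τ9.M j X) s.Ω) :=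
  bgAtMinimizerU_theta13OfThm1CC1_of_thm1RegSepCo6C1 hε hε' hB hB' ha₀ ha₁ h15 (hmono_theta13OfThm1CC1_of_betaLowerH hb hlow)

end AtMinimizerU

end Literature.MathematicalPhysics.QuantumFieldTheory.Balaban1983to89.Node00

end
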